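import Summits.NavierStokesRegularity.NavierStokesRegularity.Theorems.SwirlFreeBudgetEtaStartNorm
import Summits.NavierStokesRegularity.NavierStokesRegularity.Theorems.SwirlFreeBudgetMoserStartInner
import Summits.NavierStokesRegularity.NavierStokesRegularity.Theorems.SwirlFreeBudgetGaugeMonotone
import HarnessLib

/-!
# SwirlFreeBudget, toward crux K-18.1 `EtaMoserBound` (T-18.2): the η-Moser bound on a closed
# axis-centred sub-cylinder, from the reverse Hölder step (memo Appendix A.5–A.7 assembled for `η`)
# (seat nsreg-p4 g12)

Support file for the DORMANT route `SwirlThreshold` (crux stmt-NavierStokesRegularity-2002) and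
planner nsreg-p2's ROUND-18 Appendix A.  For `(V, P)` in the Seregin–Zajączkowski smooth class on
`Q(z₀, R)` (`z₀` on the axis), `V` axisymmetric and swirl free at every point, and a sub-cylinder
`Q((t₁, x₀), R₂)` STRICTLY inside (`R₂ < R`, `t₁ < t₀`, `t₀ - R² < t₁ - R₂²`), IF `η = ω_θ/r`
(`angVortQuot`) satisfies the reverse Hölder inequalities of memo A.5 on `[R₂/2, R₂]` (the
hypothesis `hRH`, with constant `N(1 + A₂)`, `A₂` any bound of `A((t₁,x₀), R₂)`), THEN
`|η| ≤ c · K₀³ · J^{3/2} / (R₂/4)^{15}` at every point of `Q((t₁,x₀), 3R₂/4)`, where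
`K₀ = (16 N₁² R₂²)^{5/4} 16^{15/8}`, `N₁ = N(1 + (R/R₂)A)`, `J = (2R₂(R/R₂)E)^{1/3}(4πR₂⁴)^{2/3}`
and `A = A(z₀,R)`, `E = E(z₀,R)` (`exists_abs_angVortQuot_le_sub`).  Ingredients (all tree):
`eLpNorm_top_inner_le_of_reverseHolder_pStart` (Moser chain + `p = 2/3` absorption),
`lintegral_rpow_twoThirds_angVortQuot_le` (start norm), `abs_angVortQuot_le_of_ball` (a-priori
boundedness), `cknA_sub_le`/`cknE_sub_le` (gauges), and the passage a.e. → everywhere by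
continuity of `η` off the axis (`cylRadius_sq_mul_angVortQuot_of_ball`) and of the slices at the
axis (`continuousOn_angVortQuot_of_ball`).

* `le_of_ae_le_of_continuousOn'` — a continuous function `≤ B` a.e. on an open set is `≤ B` there;
* `exists_abs_angVortQuot_le_sub` — the η-Moser bound on sub-cylinders, modulo reverse Hölder.

WHAT THIS IS NOT: not NS regularity — the reverse Hölder step (the energy inequality for `η` with
cut-offs, memo A.2–A.5) and hence `EtaMoserBound` stay OPEN; no crux claim.
-/

namespace Summit.NavierStokesRegularity.NavierStokesRegularity.Theorems.SwirlFreeBudget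

open MeasureTheory Set Filter Topology Metric Function
open scoped ENNReal NNReal
open Literature.Analysis Literature.Analysis.FluidPDE
open Literature.Analysis.FluidPDE.SereginZajaczkowski2007
open Summit.NavierStokesRegularity.NavierStokesRegularity.Theorems.AxisymmetricKatoGlobal.EulerScaling

noncomputable section

/-- **A function continuous on an open set `U ⊆ T` and `≤ B` a.e. on `T` is `≤ B` on `U`.** -/
theorem le_of_ae_le_of_continuousOn' {f : ℝ × EuclideanSpace ℝ (Fin 3) → ℝ}
    {U T : Set (ℝ × EuclideanSpace ℝ (Fin 3))} (hU : IsOpen U) (hf : ContinuousOn f U) (hUT : U ⊆ T)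
    {B : ℝ} (hae : ∀ᵐ w ∂(volume.restrict T), f w ≤ B) : ∀ w ∈ U, f w ≤ B := by
  intro w hw
  by_contra hlt
  push Not at hlt
  set O : Set (ℝ × EuclideanSpace ℝ (Fin 3)) := U ∩ f ⁻¹' Ioi B with hO
  have hOo : IsOpen O := hf.isOpen_inter_preimage hU isOpen_Ioi
  have hwO : w ∈ O := ⟨hw, hlt⟩
  have hpos : 0 < volume O := hOo.measure_pos volume ⟨w, hwO⟩
  have hnull : volume {w | w ∈ T ∧ ¬ f w ≤ B} = 0 := by
    have h := ae_imp_of_ae_restrict hae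
    rw [ae_iff] at h
    refine measure_mono_null (fun w' hw' => ?_) h
    exact fun h' => hw'.2 (h' hw'.1)
  have hsub : O ⊆ {w | w ∈ T ∧ ¬ f w ≤ B} := fun w' hw' => ⟨hUT hw'.1, not_le.2 hw'.2⟩
  exact hpos.ne' (measure_mono_null hsub hnull)

/-- **The η-Moser bound on a strictly interior axis-centred sub-cylinder, from the reverse Hölder
step.**  See the module docstring; the constant `c` depends on nothing. -/
theorem exists_abs_angVortQuot_le_sub :
    ∃ c : ℝ, 0 < c ∧ ∀ (N : ℝ), 0 < N →
      (∀ (V : ℝ → EuclideanSpace ℝ (Fin 3) → EuclideanSpace ℝ (Fin 3))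
        (P : ℝ → EuclideanSpace ℝ (Fin 3) → ℝ) (z₀ : ℝ × EuclideanSpace ℝ (Fin 3)) (R : ℝ),
        0 < R → cylRadius z₀.2 = 0 →
        IsSmoothAxisymmetricSolutionOn (parabolicCylinderOpens R z₀) V P →
        (∀ t, IsAxisymmetric (V t)) → (∀ t, HasNoSwirl (V t)) →
        ∀ (t₁ R₂ : ℝ), 0 < R₂ → R₂ < R → t₁ < z₀.1 → z₀.1 - R ^ 2 < t₁ - R₂ ^ 2 →
        ∀ A₂ : ℝ, 0 ≤ A₂ →
        cknA R₂ ((t₁, z₀.2) : ℝ × EuclideanSpace ℝ (Fin 3)) V ≤ ENNReal.ofReal A₂ →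
        ∀ m : ℝ, 1 ≤ m → ∀ ϱ ϱ' : ℝ, R₂ / 2 ≤ ϱ → ϱ < ϱ' → ϱ' ≤ R₂ →
          eLpNorm (fun w : ℝ × EuclideanSpace ℝ (Fin 3) => angVortQuot (V w.1) w.2)
              (ENNReal.ofReal (10 * m / 3))
              (volume.restrict (parabolicCylinder ϱ ((t₁, z₀.2) : ℝ × EuclideanSpace ℝ (Fin 3)))) ≤
            ENNReal.ofReal (N * (1 + A₂) * ϱ' / (ϱ' - ϱ) ^ 2) ^ (1 / m) *
              eLpNorm (fun w : ℝ × EuclideanSpace ℝ (Fin 3) => angVortQuot (V w.1) w.2)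
                (ENNReal.ofReal (2 * m))
                (volume.restrict (parabolicCylinder ϱ' ((t₁, z₀.2) : ℝ × EuclideanSpace ℝ (Fin 3))))) →
      ∀ (V : ℝ → EuclideanSpace ℝ (Fin 3) → EuclideanSpace ℝ (Fin 3))
        (P : ℝ → EuclideanSpace ℝ (Fin 3) → ℝ) (z₀ : ℝ × EuclideanSpace ℝ (Fin 3)) (R : ℝ),
        0 < R → cylRadius z₀.2 = 0 →
        IsSmoothAxisymmetricSolutionOn (parabolicCylinderOpens R z₀) V P →
        (∀ t, IsAxisymmetric (V t)) → (∀ t, HasNoSwirl (V t)) →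
        ∀ (t₁ R₂ : ℝ), 0 < R₂ → R₂ < R → t₁ < z₀.1 → z₀.1 - R ^ 2 < t₁ - R₂ ^ 2 →
        ∀ A E : ℝ, 0 ≤ A → 0 ≤ E → cknA R z₀ V ≤ ENNReal.ofReal A →
        cknE R z₀ (fun t x => fderiv ℝ (V t) x) ≤ ENNReal.ofReal E →
        ∀ z ∈ parabolicCylinder (3 * R₂ / 4) ((t₁, z₀.2) : ℝ × EuclideanSpace ℝ (Fin 3)),
          |angVortQuot (V z.1) z.2| ≤
            c * ((16 * (N * (1 + R / R₂ * A)) ^ 2 * R₂ ^ 2) ^ (5 / 4 : ℝ) * 16 ^ (15 / 8 : ℝ)) ^ (3 : ℝ) *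
              ((2 * R₂ * (R / R₂ * E)) ^ (1 / 3 : ℝ) * (4 * Real.pi * R₂ ^ 4) ^ (2 / 3 : ℝ)) ^ (3 / 2 : ℝ) /
              (R₂ - 3 * R₂ / 4) ^ (15 : ℝ) := by
  obtain ⟨c, hc, hMoser⟩ := eLpNorm_top_inner_le_of_reverseHolder_pStart (p := 2 / 3)
    (by norm_num) (by norm_num)
  obtain ⟨Cη, hCη0, hηbd⟩ := abs_angVortQuot_le_of_ball
  refine ⟨c, hc, ?_⟩
  intro N hN hRH V P z₀ R hR haxis hsm hax hns t₁ R₂ hR₂ hR₂R ht₁ hwin A E hA0 hE0 hcknA hcknE z hz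
  -- ### notation and geometry
  set z₁ : ℝ × EuclideanSpace ℝ (Fin 3) := (t₁, z₀.2) with hz₁
  set R₁ : ℝ := 3 * R₂ / 4 with hR₁
  set η : ℝ × EuclideanSpace ℝ (Fin 3) → ℝ := fun w => angVortQuot (V w.1) w.2 with hη
  set Q₂ : Set (ℝ × EuclideanSpace ℝ (Fin 3)) := parabolicCylinder R₂ z₁ with hQ₂
  have hR₁lo : R₂ / 2 ≤ R₁ := by rw [hR₁]; linarith
  have hR₁hi : R₁ < R₂ := by rw [hR₁]; linarith
  have hR₁0 : 0 < R₁ := by rw [hR₁]; positivity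
  have haxis₁ : cylRadius z₁.2 = 0 := haxis
  have hsub : Q₂ ⊆ parabolicCylinder R z₀ := parabolicCylinder_sub_subset hR₂R.le ht₁.le hwin.le
  have hsubS : Q₂ ⊆ ((parabolicCylinderOpens R z₀ : TopologicalSpace.Opens (ℝ × EuclideanSpace ℝ (Fin 3))) :
      Set (ℝ × EuclideanSpace ℝ (Fin 3))) := by rw [coe_parabolicCylinderOpens]; exact hsub
  have hQ₂open : IsOpen Q₂ := isOpen_parabolicCylinder R₂ z₁
  -- times of `Q₂` and of its closure lie in the big window
  have hwin₂ : ∀ s : ℝ, t₁ - R₂ ^ 2 ≤ s → s ≤ t₁ → s ∈ Ioo (z₀.1 - R ^ 2) z₀.1 := fun s h1 h2 =>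
    ⟨by linarith, by linarith⟩
  -- slices: smooth on `ball z₀.2 R` at the times of the big window
  have hslice : ∀ s ∈ Ioo (z₀.1 - R ^ 2) z₀.1, ContDiffOn ℝ (⊤ : ℕ∞) (V s) (ball z₀.2 R) := by
    intro s hs y hy
    have hmem : ((s, y) : ℝ × EuclideanSpace ℝ (Fin 3)) ∈
        ((parabolicCylinderOpens R z₀ : TopologicalSpace.Opens (ℝ × EuclideanSpace ℝ (Fin 3))) :
          Set (ℝ × EuclideanSpace ℝ (Fin 3))) := by
      rw [coe_parabolicCylinderOpens, mem_parabolicCylinder]; exact ⟨hs, mem_ball.1 hy⟩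
    exact (hsm.contDiffAt (s, y) hmem).contDiffWithinAt
  have hslice3 : ∀ s ∈ Ioo (z₀.1 - R ^ 2) z₀.1, ContDiffOn ℝ 3 (V s) (ball z₀.2 R) := fun s hs =>
    (hslice s hs).of_le (by norm_cast)
  -- ### the gauges on the sub-cylinder
  have hRR₂ : 0 < R / R₂ := by positivity
  set A₂ : ℝ := R / R₂ * A with hA₂
  set E₂ : ℝ := R / R₂ * E with hE₂
  have hA₂0 : 0 ≤ A₂ := by positivity
  have hE₂0 : 0 ≤ E₂ := by positivity
  have hA₂b : cknA R₂ z₁ V ≤ ENNReal.ofReal A₂ := by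
    refine (cknA_sub_le (V := V) hR₂ hR₂R.le ht₁.le hwin.le).trans ?_
    rw [hA₂, ENNReal.ofReal_mul hRR₂.le]
    exact mul_le_mul' le_rfl hcknA
  have hE₂b : cknE R₂ z₁ (fun t x => fderiv ℝ (V t) x) ≤ ENNReal.ofReal E₂ := by
    refine (cknE_sub_le (G := fun t x => fderiv ℝ (V t) x) hR₂ hR₂R.le ht₁.le hwin.le).trans ?_
    rw [hE₂, ENNReal.ofReal_mul hRR₂.le]
    exact mul_le_mul' le_rfl hcknE
  -- ### continuity of `η` off the axis on `Q₂`, measurability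
  have hGc : ContinuousOn (fun w : ℝ × EuclideanSpace ℝ (Fin 3) => fderiv ℝ (V w.1) w.2) Q₂ :=
    hsm.continuousOn_fderiv.mono hsubS
  have hcurlc : ContinuousOn (fun w : ℝ × EuclideanSpace ℝ (Fin 3) => curl (V w.1) w.2) Q₂ := by
    have e : (fun w : ℝ × EuclideanSpace ℝ (Fin 3) => curl (V w.1) w.2) =
        curlCLM ∘ fun w => fderiv ℝ (V w.1) w.2 := by funext w; rfl
    rw [e]; exact curlCLM.continuous.comp_continuousOn hGc
  set U : Set (ℝ × EuclideanSpace ℝ (Fin 3)) := Q₂ ∩ {w | cylRadius w.2 ≠ 0} with hU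
  have hUopen : IsOpen U := hQ₂open.inter (isOpen_ne_fun (continuous_cylRadius.comp continuous_snd) continuous_const)
  have hηU : ∀ w ∈ U, η w = swirl (curl (V w.1)) w.2 / cylRadius w.2 ^ 2 := by
    rintro w ⟨hwQ, hwr⟩
    have hw' := mem_parabolicCylinder.1 hwQ
    have key := cylRadius_sq_mul_angVortQuot_of_ball haxis₁ (hslice3 w.1 (hwin₂ w.1 hw'.1.1.le hw'.1.2.le))
      (hax w.1) (hns w.1) (mem_ball.2 (hw'.2.trans hR₂R))
    rw [eq_div_iff (pow_ne_zero 2 hwr), mul_comm]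
    exact key
  have hηcontU : ContinuousOn η U := by
    have h1 : ContinuousOn (fun w : ℝ × EuclideanSpace ℝ (Fin 3) =>
        swirl (curl (V w.1)) w.2 / cylRadius w.2 ^ 2) U := by
      refine ContinuousOn.div ?_ ((continuous_cylRadius.comp continuous_snd).continuousOn.pow 2)
        (fun w hw => pow_ne_zero 2 hw.2)
      have hc := hcurlc.mono (inter_subset_left : U ⊆ Q₂)
      have h0 : ContinuousOn (fun w : ℝ × EuclideanSpace ℝ (Fin 3) => (curl (V w.1) w.2) 0) U :=
        (EuclideanSpace.proj (0 : Fin 3)).continuous.comp_continuousOn hc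
      have h1' : ContinuousOn (fun w : ℝ × EuclideanSpace ℝ (Fin 3) => (curl (V w.1) w.2) 1) U :=
        (EuclideanSpace.proj (1 : Fin 3)).continuous.comp_continuousOn hc
      have hx0 : Continuous fun w : ℝ × EuclideanSpace ℝ (Fin 3) => w.2 0 :=
        (EuclideanSpace.proj (0 : Fin 3)).continuous.comp continuous_snd
      have hx1 : Continuous fun w : ℝ × EuclideanSpace ℝ (Fin 3) => w.2 1 :=
        (EuclideanSpace.proj (1 : Fin 3)).continuous.comp continuous_snd
      exact (hx0.continuousOn.mul h1').sub (hx1.continuousOn.mul h0)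
    exact h1.congr fun w hw => hηU w hw
  have hUQ : volume.restrict U = volume.restrict Q₂ := by
    refine Measure.restrict_congr_set ?_
    refine (ae_eq_set).2 ⟨?_, ?_⟩
    · rw [show U \ Q₂ = ∅ from sdiff_eq_empty.2 inter_subset_left, measure_empty]
    · refine measure_mono_null (fun w hw => ?_) volume_setOf_cylRadius_snd_eq_zero
      show cylRadius w.2 = 0
      by_contra h
      exact hw.2 ⟨hw.1, h⟩
  have hmeas : AEStronglyMeasurable η (volume.restrict Q₂) := by
    rw [← hUQ]; exact hηcontU.aestronglyMeasurable hUopen.measurableSet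
  -- ### a-priori boundedness of `η` on `Q₂` (second derivatives on a compact sub-cylinder)
  set K : Set (ℝ × EuclideanSpace ℝ (Fin 3)) := Icc (t₁ - R₂ ^ 2) t₁ ×ˢ closedBall z₀.2 R₂ with hK
  have hKc : IsCompact K := isCompact_Icc.prod (isCompact_closedBall _ _)
  have hKS : K ⊆ ((parabolicCylinderOpens R z₀ : TopologicalSpace.Opens (ℝ × EuclideanSpace ℝ (Fin 3))) :
      Set (ℝ × EuclideanSpace ℝ (Fin 3))) := by
    rintro w ⟨hw1, hw2⟩
    rw [coe_parabolicCylinderOpens, mem_parabolicCylinder]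
    exact ⟨hwin₂ w.1 hw1.1 hw1.2, lt_of_le_of_lt (mem_closedBall.1 hw2) hR₂R⟩
  obtain ⟨K₂, hK₂⟩ := hKc.exists_bound_of_continuousOn ((hsm.continuousOn_iteratedFDeriv 2).mono hKS)
  set K₂' : ℝ := max K₂ 0 with hK₂'
  have hbdQ₂ : ∀ w ∈ Q₂, |η w| ≤ Cη * K₂' := by
    intro w hw
    have hw' := mem_parabolicCylinder.1 hw
    have htw : w.1 ∈ Ioo (z₀.1 - R ^ 2) z₀.1 := hwin₂ w.1 hw'.1.1.le hw'.1.2.le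
    refine hηbd (V w.1) z₀.2 R haxis (hslice w.1 htw) (hax w.1) (hns w.1) w.2
      (mem_ball.2 (hw'.2.trans hR₂R)) K₂' (le_max_right _ _) fun y hy hyd => ?_
    have hyK : ((w.1, y) : ℝ × EuclideanSpace ℝ (Fin 3)) ∈ K :=
      ⟨⟨hw'.1.1.le, hw'.1.2.le⟩, mem_closedBall.2 (hyd.trans (le_of_lt hw'.2))⟩
    exact (hK₂ _ hyK).trans (le_max_left _ _)
  have hfin : eLpNorm η ∞ (volume.restrict Q₂) < ∞ := by
    have hb : ∀ᵐ w ∂(volume.restrict Q₂), ‖η w‖ ≤ Cη * K₂' := by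
      filter_upwards [ae_restrict_mem hQ₂open.measurableSet] with w hw
      rw [Real.norm_eq_abs]; exact hbdQ₂ w hw
    rw [eLpNorm_exponent_top]
    exact (eLpNormEssSup_le_of_ae_bound hb).trans_lt ENNReal.ofReal_lt_top
  -- ### the reverse Hölder inequalities on `[R₁, R₂]`
  have hRH' : ∀ m : ℝ, 1 ≤ m → ∀ ϱ ϱ' : ℝ, R₁ ≤ ϱ → ϱ < ϱ' → ϱ' ≤ R₂ →
      eLpNorm η (ENNReal.ofReal (10 * m / 3)) (volume.restrict (parabolicCylinder ϱ z₁)) ≤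
        ENNReal.ofReal (N * (1 + A₂) * ϱ' / (ϱ' - ϱ) ^ 2) ^ (1 / m) *
          eLpNorm η (ENNReal.ofReal (2 * m)) (volume.restrict (parabolicCylinder ϱ' z₁)) :=
    fun m hm ϱ ϱ' h1 h2 h3 =>
      hRH V P z₀ R hR haxis hsm hax hns t₁ R₂ hR₂ hR₂R ht₁ hwin A₂ hA₂0 hA₂b m hm ϱ ϱ' (hR₁lo.trans h1) h2 h3
  -- ### Moser: the essential bound on `Q(z₁, R₁)`
  have hN₁ : 0 < N * (1 + A₂) := by positivity
  have hM := hMoser η z₁ R₁ R₂ (N * (1 + A₂)) hR₁lo hR₁hi hN₁ hmeas hfin hRH'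
  -- ### the start norm
  have hI := lintegral_rpow_twoThirds_angVortQuot_le (V := V) hR₂ haxis₁
    (fun s hs => hslice3 s (hwin₂ s hs.1.le hs.2.le) |>.mono (ball_subset_ball hR₂R.le)) hax hns hGc hE₂0 hE₂b
  set J : ℝ := (2 * R₂ * E₂) ^ (1 / 3 : ℝ) * (4 * Real.pi * R₂ ^ 4) ^ (2 / 3 : ℝ) with hJ
  have hJ0 : 0 ≤ J := by positivity
  have hIreal : (∫⁻ w in parabolicCylinder R₂ z₁, ‖η w‖ₑ ^ (2 / 3 : ℝ)).toReal ≤ J :=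
    ENNReal.toReal_le_of_le_ofReal hJ0 hI
  -- ### the bound `B` and the a.e. statement on `Q(z₁, R₁)`
  set K₀ : ℝ := (16 * (N * (1 + A₂)) ^ 2 * R₂ ^ 2) ^ (5 / 4 : ℝ) * 16 ^ (15 / 8 : ℝ) with hK₀
  have hK₀0 : 0 ≤ K₀ := by positivity
  set B : ℝ := c * K₀ ^ (3 : ℝ) * J ^ (3 / 2 : ℝ) / (R₂ - R₁) ^ (15 : ℝ) with hB
  have hδ : 0 < R₂ - R₁ := sub_pos.2 hR₁hi
  have hMB : (eLpNorm η ∞ (volume.restrict (parabolicCylinder R₁ z₁))).toReal ≤ B := by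
    refine hM.trans ?_
    rw [hB, show (2 : ℝ) / (2 / 3) = 3 by norm_num, show (1 : ℝ) / (2 / 3) = 3 / 2 by norm_num,
      show (10 : ℝ) / (2 / 3) = 15 by norm_num]
    have hpow : 0 < (R₂ - R₁) ^ (15 : ℝ) := Real.rpow_pos_of_pos hδ _
    refine div_le_div_of_nonneg_right ?_ hpow.le
    gcongr
  have hM₁fin : eLpNorm η ∞ (volume.restrict (parabolicCylinder R₁ z₁)) ≠ ∞ :=
    ((eLpNorm_mono_measure η (Measure.restrict_mono (parabolicCylinder_subset_of_le hR₁0.le hR₁hi.le z₁)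
      le_rfl)).trans_lt hfin).ne
  have haeB : ∀ᵐ w ∂(volume.restrict (parabolicCylinder R₁ z₁)), |η w| ≤ B := by
    filter_upwards [ae_le_eLpNormEssSup (μ := volume.restrict (parabolicCylinder R₁ z₁)) (f := η)] with w hw
    rw [← eLpNorm_exponent_top] at hw
    have h1 : ‖η w‖ ≤ (eLpNorm η ∞ (volume.restrict (parabolicCylinder R₁ z₁))).toReal := by
      rw [← ENNReal.ofReal_le_iff_le_toReal hM₁fin, ofReal_norm]; exact hw
    rw [Real.norm_eq_abs] at h1
    exact h1.trans hMB
  -- ### a.e. → everywhere: off the axis by joint continuity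
  have hsub₁ : parabolicCylinder R₁ z₁ ⊆ Q₂ := parabolicCylinder_subset_of_le hR₁0.le hR₁hi.le z₁
  set U₁ : Set (ℝ × EuclideanSpace ℝ (Fin 3)) := parabolicCylinder R₁ z₁ ∩ {w | cylRadius w.2 ≠ 0} with hU₁
  have hU₁open : IsOpen U₁ := (isOpen_parabolicCylinder R₁ z₁).inter
    (isOpen_ne_fun (continuous_cylRadius.comp continuous_snd) continuous_const)
  have hoff : ∀ w ∈ U₁, |η w| ≤ B :=
    le_of_ae_le_of_continuousOn' hU₁open
      ((continuous_abs.comp_continuousOn hηcontU).mono (inter_subset_inter_left _ hsub₁))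
      inter_subset_left haeB
  -- ### the point `z`: off the axis directly, on the axis by slice continuity
  have hz' := mem_parabolicCylinder.1 hz
  have htz : z.1 ∈ Ioo (z₀.1 - R ^ 2) z₀.1 :=
    hwin₂ z.1 (by nlinarith [hz'.1.1]) hz'.1.2.le
  by_cases hr : cylRadius z.2 ≠ 0
  · exact hoff z ⟨hz, hr⟩
  · push Not at hr
    -- slice continuity at `z.2` and approximation by off-axis points `z.2 + ε e₀`
    have hcont : ContinuousOn (angVortQuot (V z.1)) (ball z₀.2 R) :=
      continuousOn_angVortQuot_of_ball haxis (hslice3 z.1 htz) (hax z.1) (hns z.1)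
    have hzball : z.2 ∈ ball z₀.2 R := mem_ball.2 ((hz'.2.trans hR₁hi).trans hR₂R)
    have hca : ContinuousAt (angVortQuot (V z.1)) z.2 := hcont.continuousAt (isOpen_ball.mem_nhds hzball)
    set e₀ : EuclideanSpace ℝ (Fin 3) := EuclideanSpace.single 0 1 with he₀
    set y : ℕ → EuclideanSpace ℝ (Fin 3) := fun n => z.2 + ((n : ℝ) + 1)⁻¹ • e₀ with hy
    have hy_tend : Tendsto y atTop (𝓝 z.2) := by
      have h1 : Tendsto (fun n : ℕ => ((n : ℝ) + 1)⁻¹) atTop (𝓝 0) :=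
        tendsto_one_div_add_atTop_nhds_zero_nat.congr fun n => one_div _
      have h2 : Tendsto (fun n : ℕ => z.2 + ((n : ℝ) + 1)⁻¹ • e₀) atTop (𝓝 (z.2 + (0 : ℝ) • e₀)) :=
        tendsto_const_nhds.add (h1.smul tendsto_const_nhds)
      rwa [zero_smul, add_zero] at h2
    have hy_off : ∀ n, cylRadius (y n) ≠ 0 := by
      intro n
      obtain ⟨h0, -⟩ := (cylRadius_eq_zero_iff z.2).1 hr
      intro h
      have h' := ((cylRadius_eq_zero_iff (y n)).1 h).1
      simp only [hy, he₀, PiLp.add_apply, PiLp.smul_apply, PiLp.single_apply, if_true,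
        smul_eq_mul, mul_one, h0, zero_add] at h'
      exact (inv_ne_zero (by positivity)) h'
    -- eventually `(z.1, y n) ∈ Q(z₁, R₁)`
    have hslice_open : IsOpen {x : EuclideanSpace ℝ (Fin 3) |
        ((z.1, x) : ℝ × EuclideanSpace ℝ (Fin 3)) ∈ parabolicCylinder R₁ z₁} :=
      (isOpen_parabolicCylinder R₁ z₁).preimage (Continuous.prodMk_right z.1)
    have hev : ∀ᶠ n in atTop, ((z.1, y n) : ℝ × EuclideanSpace ℝ (Fin 3)) ∈ parabolicCylinder R₁ z₁ :=
      hy_tend (hslice_open.mem_nhds hz)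
    have hlim : Tendsto (fun n => |angVortQuot (V z.1) (y n)|) atTop (𝓝 |angVortQuot (V z.1) z.2|) :=
      (continuous_abs.tendsto _).comp (hca.tendsto.comp hy_tend)
    exact le_of_tendsto hlim (hev.mono fun n hn => hoff (z.1, y n) ⟨hn, hy_off n⟩)

end

end Summit.NavierStokesRegularity.NavierStokesRegularity.Theorems.SwirlFreeBudget
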